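import Summits.BirchSwinnertonDyer.Rank1Residual.Additive.PadicClosureFormalGroupSeq
import HarnessLib

/-!
# The formal-group logarithm of `E₁(ℚ̄_p)` as a LIMIT, `Log P = lim z(pᵏP)/pᵏ`: existence,
# additivity, Galois equivariance, isometry on the small level, and `Log P = 0 ⟹ pᵏP = 0` —
# from the chart estimates alone (cell `b2b-bsdres`, CLASS-CLOSURE lane, class O10 — x1b GEN 33,
# class lead; file 17 of the local series: the analytic tool under Kobayashi's Prop. 8.11)

HONEST FRAMING (cell `b2b-bsdres`, run/shared/lean/b2b/bsd-rank1-residual/, verbatim in every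
file): the goal of the cell is to DELETE the COMBINATION-SHAPED residual classes of the
Birch–Swinnerton-Dyer formula for ALL analytic-rank `≤ 1` elliptic curves over `ℚ` — "full BSD
formula for every rank `≤ 1` curve in class `C`" assembled STRICTLY from published theorems — so
that the rank-`≤ 1` remainder becomes exactly the CONSTRUCTION-SHAPED classes, which are TYPED
(missing-input `Prop`s), NOT attempted. This is not "finishing BSD". CLASS-CLOSURE lane: prove
what is provable now; shrink each hard class to its core with data; no claim beyond stated classes;
research routes on CONSTRUCTION-SHAPED X12 / O10; census / instrument output = EVIDENCE / conjecture
items, NEVER a Literature fact; `RESIDUAL-MAP.md` marks change only by signed lines. THIS FILE: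
TOOL DEFINITIONS + THEOREMS (two definitions with bodies: `logSeq`, `limLog`; every statement
proved) — no named Literature fact, no Summits-side fact `def … : Prop`, no `sorry`, axioms
standard; nothing is booked; no label / mark / count / sub-cell moves; O10 stays OPEN /
CONSTRUCTION-SHAPED; nothing about `BSD(W, p)` of any pair is claimed.

## What is here (`Ω = PadicAlgCl p`, `v = Valued.v = ‖·‖₊`; `V` `v`-integral; `E₁ = kernel v V`)

`logSeq V P k = z(pᵏ • P)/pᵏ`, **`limLog V P = lim_k logSeq V P k`** (Mathlib `limUnder`), and for
`P ∈ E₁`: the approximants are geometrically Cauchy (`norm_logSeq_succ_sub_le`) with values in a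
finite-dimensional field (`logSeq_mem`, `exists_intermediateField_mem`), hence **converge**
(`tendsto_limLog`, file 16's completeness); **additivity** (`limLog_add/neg/sub/nsmul`, from
`|z(pᵏ(P+Q)) − z(pᵏP) − z(pᵏQ)| ≤ max² = O(|p|^{2k})`); `limLog_mem` (`Log E₁(F) ⊆ F`);
**equivariance** `limLog_eq_of_logSeq_eq` (an isometric ring endomorphism intertwining the
approximants intertwines `Log` — the Galois compatibility of [K] Prop. 8.11); **isometry on the
small level** `v (Log P) = v (z P)` and **tangency** `v (Log P − z P) ≤ v(z P)²/v(p)` for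
`v (z P) < v(p)`; **`Log P = 0 ⟹ ∃ k, pᵏ • P = 0`** and the injectivity of `Log` on any subgroup
of `E₁` without `p`-power torsion (`eq_of_limLog_eq`) — with [K] Prop. 8.7 (KERNEL, files 5–8)
this is "the logarithm is injective on `F_ss(m_n)`" of Lemma 8.9 / Prop. 8.11.

References: [SilvermanAEC2009] IV.3.2, IV.5–6, VII.2.2; [Kobayashi2003] §8.4 (8.7, 8.9, 8.11).
-/

noncomputable section

open scoped Classical NNReal Topology
open Filter

namespace Summit.BirchSwinnertonDyer.Rank1Residual.Additive

open Literature.NumberTheory.EllipticCurves Literature.NumberTheory.EllipticCurves.FormalGroupChart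
  WeierstrassCurve

/-! ## §4 `limLog` on `E₁(ℚ̄_p)` -/

section LimLog

variable {p : ℕ} [hp : Fact p.Prime] (V : WeierstrassCurve (PadicAlgCl p))
  [hV : V.IsIntegral (Valued.v (R := PadicAlgCl p)).integer]

/-- The approximants `a_k(P) = z(pᵏ • P) / pᵏ`. [cite: SilvermanAEC2009, IV.5–IV.6] -/
def logSeq (P : V.toAffine.Point) (k : ℕ) : PadicAlgCl p :=
  (p ^ k • P).zCoord / (p : PadicAlgCl p) ^ k

/-- **The limit logarithm** `Log P = lim_k z(pᵏ • P)/pᵏ` on the points of a Weierstrass equation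
over `ℚ̄_p` (Mathlib `limUnder`; meaningful on `E₁`, where the limit exists, `tendsto_limLog`). On
`E₁(ℚ̄_p)` this is the logarithm of the formal group `Ê` (Silverman, *AEC*, IV.5–6), characterised
as the unique additive function with `Log P = z(P) + O(z(P)²)`. [cite: SilvermanAEC2009, IV.5 and Prop. VII.2.2]
[cite: Kobayashi2003, §8.4 (log on F_ss(m_n))] -/
def limLog (P : V.toAffine.Point) : PadicAlgCl p :=
  limUnder atTop (logSeq V P)

variable {V}

omit hV in
/-- `a_0(P) = z(P)`. [folklore] -/
theorem logSeq_zero (P : V.toAffine.Point) : logSeq V P 0 = P.zCoord := by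
  simp [logSeq]

omit hV in
/-- The difference of consecutive approximants: `a_{k+1} − a_k = (z(pᵏ⁺¹P) − p·z(pᵏP))/pᵏ⁺¹`.
[folklore] -/
theorem logSeq_succ_sub (P : V.toAffine.Point) (k : ℕ) :
    logSeq V P (k + 1) - logSeq V P k =
      ((p ^ (k + 1) • P).zCoord - (p : PadicAlgCl p) * (p ^ k • P).zCoord) /
        (p : PadicAlgCl p) ^ (k + 1) := by
  have hp0 : (p : PadicAlgCl p) ≠ 0 := Nat.cast_ne_zero.mpr hp.out.ne_zero
  rw [logSeq, logSeq]
  field_simp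
  ring

/-- **The approximants are Cauchy, geometrically**: for `P ∈ E₁` with `|z(p^{k₀}P)| < |p|`,
`‖a_{k+1} − a_k‖ ≤ (|z(p^{k₀}P)|²·|p|^{−2k₀−1}) · |p|ᵏ` for `k ≥ k₀`. [cite: SilvermanAEC2009, IV.3.2, IV.6] -/
theorem norm_logSeq_succ_sub_le {P : V.toAffine.Point} (hP : P ∈ kernel Valued.v V) {k₀ : ℕ}
    (hk₀ : Valued.v (p ^ k₀ • P).zCoord < Valued.v (p : PadicAlgCl p)) (k : ℕ) :
    ‖logSeq V P (k + k₀ + 1) - logSeq V P (k + k₀)‖ ≤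
      ((Valued.v (p ^ k₀ • P).zCoord ^ 2 * ((Valued.v (p : PadicAlgCl p)) ^ (k₀ + 1))⁻¹ : ℝ≥0) : ℝ)
        * ((Valued.v (p : PadicAlgCl p) : ℝ≥0) : ℝ) ^ k := by
  set Q := p ^ k₀ • P with hQdef
  have hQ : Q ∈ kernel Valued.v V := pow_smul_mem_kernel p k₀ hP
  set c := Valued.v (p : PadicAlgCl p) with hc
  have hc0 : c ≠ 0 := v_prime_ne_zero
  -- `p^(k+k₀) • P = p^k • Q`
  have hshift : ∀ j, p ^ (j + k₀) • P = p ^ j • Q := fun j => by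
    rw [hQdef, pow_add, mul_nsmul']
  have hlev : Valued.v (p ^ k • Q).zCoord = c ^ k * Valued.v Q.zCoord :=
    val_zCoord_pow_smul_eq_of_lt p hQ hk₀ k
  -- the estimate in `ℝ≥0`
  have key : Valued.v (logSeq V P (k + k₀ + 1) - logSeq V P (k + k₀)) ≤
      Valued.v Q.zCoord ^ 2 * (c ^ (k₀ + 1))⁻¹ * c ^ k := by
    rw [logSeq_succ_sub, map_div₀, map_pow, show k + k₀ + 1 = (k + 1) + k₀ by ring, hshift (k + 1),
      hshift k]
    have hnum := val_zCoord_pow_succ_smul_sub_le (w := Valued.v) p hQ k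
    rw [hlev] at hnum
    rw [← hc, div_le_iff₀ (pow_pos (pos_iff_ne_zero.mpr hc0) _)]
    refine hnum.trans (le_of_eq ?_)
    field_simp
    ring
  rw [← coe_nnnorm, ← PadicAlgCl.valuation_def, ← NNReal.coe_pow, ← NNReal.coe_mul, NNReal.coe_le_coe]
  exact key

/-- For `P ∈ E₁` there is a level `k₀` with `|z(p^{k₀} P)| < |p|`. [cite: SilvermanAEC2009, Prop. VII.2.2] -/
theorem exists_val_zCoord_pow_smul_lt {P : V.toAffine.Point} (hP : P ∈ kernel Valued.v V) :
    ∃ k₀, Valued.v (p ^ k₀ • P).zCoord < Valued.v (p : PadicAlgCl p) := by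
  set θ := max (Valued.v (p : PadicAlgCl p)) (Valued.v P.zCoord) with hθ
  have hθ1 : θ < 1 := max_lt v_prime_lt_one (val_zCoord_lt_one hP)
  have hlim : Tendsto (fun k => θ ^ k * Valued.v P.zCoord) atTop (𝓝 0) := by
    simpa using (NNReal.tendsto_pow_atTop_nhds_zero_of_lt_one hθ1).mul_const (Valued.v P.zCoord)
  have hpos : 0 < Valued.v (p : PadicAlgCl p) := pos_iff_ne_zero.mpr v_prime_ne_zero
  obtain ⟨k₀, hk₀⟩ := (hlim.eventually (gt_mem_nhds hpos)).exists
  exact ⟨k₀, lt_of_le_of_lt (val_zCoord_pow_smul_le p hP k₀) hk₀⟩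

omit hV in
/-- All approximants of a point with coordinates in a subfield containing the `aᵢ` lie in it.
[folklore] -/
theorem logSeq_mem {S : Subfield (PadicAlgCl p)}
    (hVS : V.a₁ ∈ S ∧ V.a₂ ∈ S ∧ V.a₃ ∈ S ∧ V.a₄ ∈ S ∧ V.a₆ ∈ S)
    {P : V.toAffine.Point} (hP : P ∈ subfieldPoints V S hVS) (k : ℕ) : logSeq V P k ∈ S :=
  S.div_mem (zCoord_mem_of_mem_subfieldPoints hVS ((subfieldPoints V S hVS).nsmul_mem hP _))
    (S.pow_mem (natCast_mem S p) k)

omit hV in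
/-- Every point has coordinates in SOME finite-dimensional intermediate field containing the
coefficients (`ℚ̄_p/ℚ_p` is algebraic). [folklore] -/
theorem exists_intermediateField_mem (P : V.toAffine.Point) :
    ∃ F : IntermediateField ℚ_[p] (PadicAlgCl p), FiniteDimensional ℚ_[p] F ∧
      ∃ hVS : V.a₁ ∈ F.toSubfield ∧ V.a₂ ∈ F.toSubfield ∧ V.a₃ ∈ F.toSubfield ∧
        V.a₄ ∈ F.toSubfield ∧ V.a₆ ∈ F.toSubfield, P ∈ subfieldPoints V F.toSubfield hVS := by
  rcases P with _ | ⟨x, y, h⟩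
  · refine ⟨IntermediateField.adjoin ℚ_[p] {V.a₁, V.a₂, V.a₃, V.a₄, V.a₆}, ?_, ?_⟩
    · exact IntermediateField.finiteDimensional_adjoin fun z _ => Algebra.IsIntegral.isIntegral z
    · refine ⟨⟨?_, ?_, ?_, ?_, ?_⟩, ?_⟩
      iterate 5 exact IntermediateField.subset_adjoin ℚ_[p] _ (by simp)
      rw [← WeierstrassCurve.Affine.Point.zero_def]
      exact AddSubgroup.zero_mem _
  · refine ⟨IntermediateField.adjoin ℚ_[p] {V.a₁, V.a₂, V.a₃, V.a₄, V.a₆, x, y}, ?_, ?_⟩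
    · exact IntermediateField.finiteDimensional_adjoin fun z _ => Algebra.IsIntegral.isIntegral z
    · refine ⟨⟨?_, ?_, ?_, ?_, ?_⟩, ?_⟩
      iterate 5 exact IntermediateField.subset_adjoin ℚ_[p] _ (by simp)
      exact (some_mem_subfieldPoints_iff _ h).mpr
        ⟨IntermediateField.subset_adjoin ℚ_[p] _ (by simp), IntermediateField.subset_adjoin ℚ_[p] _ (by simp)⟩

/-- **Existence of the limit, inside the field of the point**: for `P ∈ E₁` with coordinates in a
finite-dimensional `F ⊇ {aᵢ}`, the approximants converge to an element of `F`. [cite: SilvermanAEC2009, IV.6 and Prop. VII.2.2] -/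
theorem exists_tendsto_logSeq_mem {F : IntermediateField ℚ_[p] (PadicAlgCl p)} [FiniteDimensional ℚ_[p] F]
    (hVS : V.a₁ ∈ F.toSubfield ∧ V.a₂ ∈ F.toSubfield ∧ V.a₃ ∈ F.toSubfield ∧ V.a₄ ∈ F.toSubfield ∧
      V.a₆ ∈ F.toSubfield)
    {P : V.toAffine.Point} (hP : P ∈ kernel Valued.v V) (hPF : P ∈ subfieldPoints V F.toSubfield hVS) :
    ∃ L ∈ F, Tendsto (logSeq V P) atTop (𝓝 L) := by
  obtain ⟨k₀, hk₀⟩ := exists_val_zCoord_pow_smul_lt hP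
  -- the shifted sequence is Cauchy (geometric differences), hence converges in `F`
  have hC : CauchySeq fun k => logSeq V P (k + k₀) := by
    refine cauchySeq_of_le_geometric (((Valued.v (p : PadicAlgCl p) : ℝ≥0)) : ℝ)
      ((Valued.v (p ^ k₀ • P).zCoord ^ 2 * ((Valued.v (p : PadicAlgCl p)) ^ (k₀ + 1))⁻¹ : ℝ≥0) : ℝ)
      (by rw [← NNReal.coe_one, NNReal.coe_lt_coe]; exact v_prime_lt_one) fun k => ?_
    rw [dist_eq_norm, ← norm_neg, neg_sub]
    show ‖logSeq V P (k + 1 + k₀) - logSeq V P (k + k₀)‖ ≤ _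
    rw [Nat.add_right_comm]
    exact norm_logSeq_succ_sub_le hP hk₀ k
  obtain ⟨L, hLF, hL⟩ := exists_lim_of_cauchySeq F (fun k => logSeq_mem hVS hPF (k + k₀)) hC
  exact ⟨L, hLF, (tendsto_add_atTop_iff_nat k₀).mp hL⟩

/-- **The limit exists on `E₁`**: `a_k(P) → Log P`. [cite: SilvermanAEC2009, IV.6 and Prop. VII.2.2] -/
theorem tendsto_limLog {P : V.toAffine.Point} (hP : P ∈ kernel Valued.v V) :
    Tendsto (logSeq V P) atTop (𝓝 (limLog V P)) := by
  obtain ⟨F, hF, hVS, hPF⟩ := exists_intermediateField_mem (V := V) P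
  haveI := hF
  obtain ⟨L, -, hL⟩ := exists_tendsto_logSeq_mem hVS hP hPF
  exact tendsto_nhds_limUnder ⟨L, hL⟩

omit hV in
/-- `Log P` is the limit of any sequence equal to the approximants. [folklore] -/
theorem limLog_eq_of_tendsto {P : V.toAffine.Point} {L : PadicAlgCl p}
    (hL : Tendsto (logSeq V P) atTop (𝓝 L)) : limLog V P = L :=
  hL.limUnder_eq

/-- **`Log P ∈ F`** when `P ∈ E₁` has coordinates in the finite-dimensional field `F ⊇ {aᵢ}`
(e.g. `Log` maps `E₁(k_n)` into `k_n`). [cite: Kobayashi2003, Prop. 8.11] -/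
theorem limLog_mem {F : IntermediateField ℚ_[p] (PadicAlgCl p)} [FiniteDimensional ℚ_[p] F]
    (hVS : V.a₁ ∈ F.toSubfield ∧ V.a₂ ∈ F.toSubfield ∧ V.a₃ ∈ F.toSubfield ∧ V.a₄ ∈ F.toSubfield ∧
      V.a₆ ∈ F.toSubfield)
    {P : V.toAffine.Point} (hP : P ∈ kernel Valued.v V) (hPF : P ∈ subfieldPoints V F.toSubfield hVS) :
    limLog V P ∈ F := by
  obtain ⟨L, hLF, hL⟩ := exists_tendsto_logSeq_mem hVS hP hPF
  rwa [limLog_eq_of_tendsto hL]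

omit hV in
/-- `Log O = 0`. [folklore] -/
theorem limLog_zero : limLog V (0 : V.toAffine.Point) = 0 := by
  refine limLog_eq_of_tendsto (tendsto_const_nhds.congr fun k => ?_)
  simp [logSeq]

/-- **Additivity: `Log (P + Q) = Log P + Log Q` on `E₁`** (`|z(pᵏ(P+Q)) − z(pᵏP) − z(pᵏQ)| ≤ max² =
O(|p|^{2k})`, divided by `|p|ᵏ`). Silverman, *AEC*, IV.5 (the logarithm is a homomorphism
`Ê → 𝔾̂_a`). [cite: SilvermanAEC2009, IV.5 and Prop. VII.2.2] -/
theorem limLog_add {P Q : V.toAffine.Point} (hP : P ∈ kernel Valued.v V) (hQ : Q ∈ kernel Valued.v V) :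
    limLog V (P + Q) = limLog V P + limLog V Q := by
  obtain ⟨kP, hkP⟩ := exists_val_zCoord_pow_smul_lt hP
  obtain ⟨kQ, hkQ⟩ := exists_val_zCoord_pow_smul_lt hQ
  set c := Valued.v (p : PadicAlgCl p) with hc
  have hc0 : c ≠ 0 := v_prime_ne_zero
  have hc1 : c < 1 := v_prime_lt_one
  have hPQ : P + Q ∈ kernel Valued.v V := (kernel Valued.v V).add_mem hP hQ
  -- the difference of approximant sequences tends to `0`
  have hdiff : Tendsto (fun k => logSeq V (P + Q) k - (logSeq V P k + logSeq V Q k)) atTop (𝓝 0) := by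
    -- bound: `‖·‖ ≤ D · c^k` for `k ≥ k₁ = max kP kQ`
    set k₁ := max kP kQ with hk₁
    have hlevP : ∀ k, Valued.v (p ^ (k + k₁) • P).zCoord ≤ c ^ k := by
      intro k
      have hkP1 : kP ≤ k₁ := le_max_left _ _
      have h1 : p ^ (k + k₁) • P = p ^ (k + (k₁ - kP)) • (p ^ kP • P) := by
        rw [← mul_nsmul', ← pow_add, show k + (k₁ - kP) + kP = k + k₁ by omega]
      rw [h1, val_zCoord_pow_smul_eq_of_lt p (pow_smul_mem_kernel p kP hP) hkP, pow_add]
      calc c ^ k * c ^ (k₁ - kP) * Valued.v (p ^ kP • P).zCoord ≤ c ^ k * 1 * 1 := by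
            refine mul_le_mul' (mul_le_mul' le_rfl (pow_le_one₀ zero_le hc1.le)) ?_
            exact (val_zCoord_lt_one (pow_smul_mem_kernel p kP hP)).le
        _ = c ^ k := by ring
    have hlevQ : ∀ k, Valued.v (p ^ (k + k₁) • Q).zCoord ≤ c ^ k := by
      intro k
      have hkQ1 : kQ ≤ k₁ := le_max_right _ _
      have h1 : p ^ (k + k₁) • Q = p ^ (k + (k₁ - kQ)) • (p ^ kQ • Q) := by
        rw [← mul_nsmul', ← pow_add, show k + (k₁ - kQ) + kQ = k + k₁ by omega]
      rw [h1, val_zCoord_pow_smul_eq_of_lt p (pow_smul_mem_kernel p kQ hQ) hkQ, pow_add]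
      calc c ^ k * c ^ (k₁ - kQ) * Valued.v (p ^ kQ • Q).zCoord ≤ c ^ k * 1 * 1 := by
            refine mul_le_mul' (mul_le_mul' le_rfl (pow_le_one₀ zero_le hc1.le)) ?_
            exact (val_zCoord_lt_one (pow_smul_mem_kernel p kQ hQ)).le
        _ = c ^ k := by ring
    have hbound : ∀ k, Valued.v (logSeq V (P + Q) (k + k₁) -
        (logSeq V P (k + k₁) + logSeq V Q (k + k₁))) ≤ (c ^ k₁)⁻¹ * c ^ k := by
      intro k
      have e : logSeq V (P + Q) (k + k₁) - (logSeq V P (k + k₁) + logSeq V Q (k + k₁)) =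
          ((p ^ (k + k₁) • P + p ^ (k + k₁) • Q).zCoord - (p ^ (k + k₁) • P).zCoord -
            (p ^ (k + k₁) • Q).zCoord) / (p : PadicAlgCl p) ^ (k + k₁) := by
        simp only [logSeq, nsmul_add]; ring
      have hPk : p ^ (k + k₁) • P ∈ kernel Valued.v V := (kernel Valued.v V).nsmul_mem hP _
      have hQk : p ^ (k + k₁) • Q ∈ kernel Valued.v V := (kernel Valued.v V).nsmul_mem hQ _
      rw [e, map_div₀, map_pow, ← hc, div_le_iff₀ (pow_pos (pos_iff_ne_zero.mpr hc0) _)]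
      refine (val_zCoord_add_sub_le hPk hQk).trans ?_
      calc max (Valued.v (p ^ (k + k₁) • P).zCoord) (Valued.v (p ^ (k + k₁) • Q).zCoord) ^ 2
          ≤ (c ^ k) ^ 2 := pow_le_pow_left₀ zero_le (max_le (hlevP k) (hlevQ k)) 2
        _ = (c ^ k₁)⁻¹ * c ^ k * c ^ (k + k₁) := by field_simp; ring
    rw [← tendsto_add_atTop_iff_nat k₁]
    rw [tendsto_iff_norm_sub_tendsto_zero]
    simp only [sub_zero]
    have hgeo : Tendsto (fun k => (((c ^ k₁)⁻¹ * c ^ k : ℝ≥0) : ℝ)) atTop (𝓝 0) := by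
      rw [← NNReal.coe_zero, NNReal.tendsto_coe]
      simpa using (NNReal.tendsto_pow_atTop_nhds_zero_of_lt_one hc1).const_mul ((c ^ k₁)⁻¹)
    refine squeeze_zero (fun _ => norm_nonneg _) (fun k => ?_) hgeo
    rw [← coe_nnnorm, ← PadicAlgCl.valuation_def, NNReal.coe_le_coe]
    exact hbound k
  have hsum := (tendsto_limLog hP).add (tendsto_limLog hQ)
  have hPQlim : Tendsto (logSeq V (P + Q)) atTop (𝓝 (limLog V P + limLog V Q)) := by
    have := hdiff.add hsum
    simp only [zero_add, sub_add_cancel] at this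
    exact this
  exact limLog_eq_of_tendsto hPQlim

/-- `Log (n • P) = n • Log P` on `E₁`. [cite: SilvermanAEC2009, IV.5] -/
theorem limLog_nsmul {P : V.toAffine.Point} (hP : P ∈ kernel Valued.v V) (n : ℕ) :
    limLog V (n • P) = n • limLog V P := by
  induction n with
  | zero => simp [limLog_zero]
  | succ n ih => rw [succ_nsmul, limLog_add ((kernel Valued.v V).nsmul_mem hP _) hP, ih, succ_nsmul]

/-- `Log (−P) = −Log P` on `E₁`. [cite: SilvermanAEC2009, IV.5] -/
theorem limLog_neg {P : V.toAffine.Point} (hP : P ∈ kernel Valued.v V) :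
    limLog V (-P) = -limLog V P := by
  have h := limLog_add ((kernel Valued.v V).neg_mem hP) hP
  rw [neg_add_cancel, limLog_zero] at h
  linear_combination -h

/-- `Log (P − Q) = Log P − Log Q` on `E₁`. [cite: SilvermanAEC2009, IV.5] -/
theorem limLog_sub {P Q : V.toAffine.Point} (hP : P ∈ kernel Valued.v V) (hQ : Q ∈ kernel Valued.v V) :
    limLog V (P - Q) = limLog V P - limLog V Q := by
  rw [sub_eq_add_neg, limLog_add hP ((kernel Valued.v V).neg_mem hQ), limLog_neg hQ, sub_eq_add_neg]

/-- **Equivariance** (abstract form): if `σ` is an isometric ring endomorphism of `ℚ̄_p` and `P'` a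
point whose approximants are the `σ`-images of those of `P` (e.g. `P' = σ_* P` for a Galois
automorphism `σ`, since `z(σ_* Q) = σ(z(Q))` and `σ_*` commutes with multiplication by `pᵏ`), and
`P ∈ E₁`, then `Log P' = σ (Log P)` — "the logarithm … is compatible with the Galois action".
[cite: Kobayashi2003, Prop. 8.11 (proof)] -/
theorem limLog_eq_of_logSeq_eq {P : V.toAffine.Point} (hP : P ∈ kernel Valued.v V)
    {V' : WeierstrassCurve (PadicAlgCl p)} {P' : V'.toAffine.Point}
    (σ : PadicAlgCl p →+* PadicAlgCl p) (hσ : ∀ x, ‖σ x‖ = ‖x‖)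
    (hseq : ∀ k, logSeq V' P' k = σ (logSeq V P k)) : limLog V' P' = σ (limLog V P) := by
  have hcont : Continuous σ :=
    AddMonoidHomClass.isometry_of_norm σ hσ |>.continuous
  have h : Tendsto (logSeq V' P') atTop (𝓝 (σ (limLog V P))) := by
    have := (hcont.tendsto _).comp (tendsto_limLog hP)
    exact this.congr fun k => (hseq k).symm
  exact h.limUnder_eq

/-- **Isometry on the small level**: for `P ∈ E₁` with `|z(P)| < |p|`, `|Log P| = |z(P)|`
(all approximants have absolute value `|z(P)|`). [cite: SilvermanAEC2009, Thm. IV.6.4(b)] -/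
theorem v_limLog_eq {P : V.toAffine.Point} (hP : P ∈ kernel Valued.v V)
    (hlt : Valued.v P.zCoord < Valued.v (p : PadicAlgCl p)) :
    Valued.v (limLog V P) = Valued.v P.zCoord := by
  have hconst : ∀ k, Valued.v (logSeq V P k) = Valued.v P.zCoord := by
    intro k
    rw [logSeq, map_div₀, map_pow, val_zCoord_pow_smul_eq_of_lt p hP hlt k,
      mul_div_cancel_left₀ _ (pow_ne_zero _ v_prime_ne_zero)]
  have h1 : Tendsto (fun k => ‖logSeq V P k‖) atTop (𝓝 ‖limLog V P‖) := (tendsto_limLog hP).norm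
  have h2 : Tendsto (fun k => ‖logSeq V P k‖) atTop (𝓝 ‖P.zCoord‖) := by
    refine tendsto_const_nhds.congr fun k => ?_
    rw [← coe_nnnorm, ← coe_nnnorm, ← PadicAlgCl.valuation_def, ← PadicAlgCl.valuation_def, hconst]
  have := tendsto_nhds_unique h1 h2
  rw [PadicAlgCl.valuation_def, PadicAlgCl.valuation_def]
  ext
  rw [coe_nnnorm, coe_nnnorm, this]

/-- **Tangency**: for `P ∈ E₁` with `|z(P)| < |p|`, `|Log P − z(P)| ≤ |z(P)|²/|p|` (every
approximant is within that distance of `a_0 = z(P)`). [cite: SilvermanAEC2009, IV.5–IV.6] -/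
theorem v_limLog_sub_zCoord_le {P : V.toAffine.Point} (hP : P ∈ kernel Valued.v V)
    (hlt : Valued.v P.zCoord < Valued.v (p : PadicAlgCl p)) :
    Valued.v (limLog V P - P.zCoord) ≤ Valued.v P.zCoord ^ 2 * (Valued.v (p : PadicAlgCl p))⁻¹ := by
  set c := Valued.v (p : PadicAlgCl p) with hc
  have hc0 : c ≠ 0 := v_prime_ne_zero
  have hc1 : c < 1 := v_prime_lt_one
  -- consecutive differences `≤ |z P|²/|p| · cᵏ`
  have hk0 : Valued.v (p ^ 0 • P).zCoord < c := by simpa using hlt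
  have hstep : ∀ k, Valued.v (logSeq V P (k + 1) - logSeq V P k) ≤
      Valued.v P.zCoord ^ 2 * c⁻¹ * c ^ k := by
    intro k
    have h := norm_logSeq_succ_sub_le hP hk0 k
    simp only [add_zero, pow_zero, one_smul, zero_add, pow_one] at h
    rw [← coe_nnnorm, ← PadicAlgCl.valuation_def, ← NNReal.coe_pow, ← NNReal.coe_mul,
      NNReal.coe_le_coe] at h
    exact h
  have hall' : ∀ k, Valued.v (logSeq V P k - logSeq V P 0) ≤ Valued.v P.zCoord ^ 2 * c⁻¹ := by
    intro k
    induction k with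
    | zero => rw [sub_self, map_zero]; exact zero_le
    | succ k ih =>
      have e : logSeq V P (k + 1) - logSeq V P 0 =
          (logSeq V P (k + 1) - logSeq V P k) + (logSeq V P k - logSeq V P 0) := by ring
      rw [e]
      refine (Valuation.map_add _ _ _).trans (max_le ((hstep k).trans ?_) ih)
      exact mul_le_of_le_one_right zero_le (pow_le_one₀ zero_le hc1.le)
  have hall : ∀ k, Valued.v (logSeq V P k - P.zCoord) ≤ Valued.v P.zCoord ^ 2 * c⁻¹ := fun k => by
    have h := hall' k
    rwa [logSeq_zero] at h
  -- pass to the limit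
  have hlim : Tendsto (fun k => logSeq V P k - P.zCoord) atTop (𝓝 (limLog V P - P.zCoord)) :=
    (tendsto_limLog hP).sub tendsto_const_nhds
  have hle : ∀ k, ‖logSeq V P k - P.zCoord‖ ≤ ((Valued.v P.zCoord ^ 2 * c⁻¹ : ℝ≥0) : ℝ) := fun k => by
    rw [← coe_nnnorm, ← PadicAlgCl.valuation_def, NNReal.coe_le_coe]; exact hall k
  have := le_of_tendsto' hlim.norm hle
  rwa [← coe_nnnorm, ← PadicAlgCl.valuation_def, NNReal.coe_le_coe] at this

/-- **`Log P = 0 ⟹ P` is `p`-power torsion** (`P ∈ E₁`): at a level `k₀` with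
`|z(p^{k₀}P)| < |p|`, `|Log (p^{k₀}P)| = |z(p^{k₀}P)|` and `Log (p^{k₀}P) = p^{k₀} Log P = 0`, so
`z(p^{k₀} P) = 0`, i.e. `p^{k₀} • P = O`. With [K] Prop. 8.7 (no `p`-power torsion in `E(k_n)`) this
is the injectivity of the logarithm on `Ê(m_n)`. [cite: Kobayashi2003, Prop. 8.7 and Lemma 8.9 (proof)]
[cite: SilvermanAEC2009, Thm. IV.6.4] -/
theorem exists_pow_smul_eq_zero_of_limLog_eq_zero {P : V.toAffine.Point} (hP : P ∈ kernel Valued.v V)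
    (h0 : limLog V P = 0) : ∃ k : ℕ, p ^ k • P = 0 := by
  obtain ⟨k₀, hk₀⟩ := exists_val_zCoord_pow_smul_lt hP
  refine ⟨k₀, ?_⟩
  have hQ : p ^ k₀ • P ∈ kernel Valued.v V := pow_smul_mem_kernel (w := Valued.v) p k₀ hP
  have hlog : limLog V (p ^ k₀ • P) = 0 := by
    rw [limLog_nsmul hP, h0, smul_zero]
  have hv := v_limLog_eq hQ hk₀
  rw [hlog, map_zero] at hv
  exact (zCoord_eq_zero_iff hQ).mp ((Valuation.zero_iff _).mp hv.symm)

/-- Injectivity form: on a subgroup of `E₁` without `p`-power torsion, `Log` is injective.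
[cite: Kobayashi2003, Lemma 8.9 (proof: "log is injective on F_ss(m_n)")] -/
theorem eq_of_limLog_eq {A : AddSubgroup V.toAffine.Point} (hA : A ≤ kernel Valued.v V)
    (htors : ∀ Q ∈ A, ∀ k : ℕ, p ^ k • Q = 0 → Q = 0) {P Q : V.toAffine.Point} (hP : P ∈ A)
    (hQ : Q ∈ A) (h : limLog V P = limLog V Q) : P = Q := by
  have hPQ : P - Q ∈ A := sub_mem hP hQ
  have h0 : limLog V (P - Q) = 0 := by rw [limLog_sub (hA hP) (hA hQ), h, sub_self]
  obtain ⟨k, hk⟩ := exists_pow_smul_eq_zero_of_limLog_eq_zero (hA hPQ) h0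
  exact sub_eq_zero.mp (htors _ hPQ k hk)

end LimLog

end Summit.BirchSwinnertonDyer.Rank1Residual.Additive

end
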